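import Mathlib
import Literature.MathematicalPhysics.QuantumFieldTheory.BalabanImbrieJaffe1984to88.BIJ85Eq7117Tau1Symbol
import Literature.MathematicalPhysics.QuantumFieldTheory.BalabanImbrieJaffe1984to88.BIJ85Eq7113SymbolIdentification

/-!
# `BalabanImbrieJaffe1984to88.BIJ85Eq7114Tau1Identification` — T. Bałaban, J. Imbrie, A. Jaffe, *Renormalization of the Higgs model:
minimizers, propagators and the stability of mean field theory*, Commun. Math. Phys. **97** (1985) 299–329 [BalabanImbrieJaffe1985]:
Sect. 7.1 pp. 322–323 (7.1.14), (7.1.15), (7.1.17) — **`τ₁(p′)` OF THE τ₁ OF RECORD IS (7.1.14), `τ₂(p′)` OF THE τ₂ OF RECORD IS (7.1.15)**,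
at every generic dual momentum: the multiplication operator of p33's configuration-space `τ₁ = Q^e_k(I − P_∂)Q^{e*}_k` (`tau1Torus`;
symbol = file 2's `symb tau1Matrix p′`) satisfies **`⟨ψ, τ₁(p′)ψ⟩ = Re⟨ψ^asym, tau1Sym (η_k) M (p′) ψ^asym⟩`** with r15's (7.1.14) symbol
VERBATIM, and `τ₂ = σ_k − τ₁` (`tau2Torus`) satisfies **`⟨ψ, τ₂(p′)ψ⟩ = Re⟨ψ^asym, tau2Sym (η_k) M (p′) ψ^asym⟩`** with r15's (7.1.15)–(7.1.16)
symbol VERBATIM (`L^k = 2M + 1`; all `p′_μ ≠ 0`) — by file 2 (symbol = ½·unconstrained fibre minimum), the unconstrained analogue of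
seat p10's fibre algebra (*"Q^{e*}_kf = ∂B₀ + R, R ⟂ curls"*: `BIJ85Eq7113DerivationPart2.qeStar_eq`/`sum_curl_remF`, `…Part3.pNormSq_remF`:
`min_A ‖∂A − Q^{e*}_kf‖² = ‖R‖² = ⟨f, τ₁f⟩`), and this generation's `BIJ85Eq7113SymbolIdentification` (σ_k(p′) = τ₁ + τ₂) — file 3 of 3;
closes p33's `BIJ85Tau1Config717` scope note *"the identification of this τ₂'s momentum symbol with (7.1.15) is … not claimed"* at the
generic fibres

statement-level skeleton of published theorems with citation tags; proofs where landed; nothing here is a claim about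
the Yang–Mills mass gap

PDF held: `paper:balaban1985-cmp97-bij-higgs-minimizers` (journal page = PDF page + 298).  Text read as images: PDF pp. 24–25 (journal
322–323; `run/shared/lean/pub/pub-balaban/t4/b2b-balaban-t4-lit2/renders/bij1985/1985-cmp97-bij-higgs-minimizers-p024-x2.png`, `…-p025-x2.png`).

THE PRINTED TEXT (verbatim, pp. 322–323).  *"We express σ_k as a sum of two terms σ_k = τ₁ + τ₂. (7.1.13) Here τ₁ vanishes on curls. Thus
if f = ∂B, then τ₁f = 0. Explicitly τ_{1,μνλκ}(p′) = ½Σ_l(|u|²/(v̄_μv̄_νv_λv_κ)[δ_{μλ} − ∂_μ∂̄_λ/Δ][δ_{νκ} − ∂_ν∂̄_κ/Δ])(p′+l), (7.1.14) and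
τ_{2,μνλκ}(p′) = (a_μā_λ(φ_νφ_κ)^{−1/2}[δ_{νκ} − (∂^{(1)}_ν∂̄^{(1)}_κ/√(φ_νφ_κ))(Σ_ρ|∂^{(1)}_ρ|²/φ_ρ)^{−1}])(p′). (7.1.15) … The general form of
τ₁ in configuration space is evident from (7.1.11), (7.1.14) namely τ₁ = Q^e_k(I − P_∂)Q^{e*}_k, (7.1.17)"*.

CITATION HEADER (lean-in-tree rule).  Part of the lit-balaban TYPED SKELETON (HOME `run/shared/lean/pub/lit-balaban/`), Phase-2 seat p27
(gen 6), unit `lit-balaban-p27`; rows **C1.Eq7.1.13-7.1.19**, **C1.Eq7.1.2-7.1.12** of `HOME/SKELETON.md` (owner r15, referee ref-5).  INPUTS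
(all landed, by name): file 2 `BIJ85Eq7117Tau1Symbol` (`symb_tau1Matrix_form_eq_half_fibreMinU`, `tau1Matrix`, `tau2Matrix`,
`sigmaMatrix_eq_tau1Matrix_add_tau2Matrix`), file 1 `BIJ85Eq7117FibreMinFree` (`fibreMinU`), `BIJ85Eq7113SymbolIdentification`
(`symb_sigmaMatrix_form_eq_sigmaSym`, `energyC_comp_res`, `fibreMin_congr_n`, `asymO_swap`, `eta_eq_inv_of_pow_eq`), seat p10's
`BIJ85Eq7113Derivation` (`energy`, `bZero`, `remF`, `pNormSq`, `pInner`, `curlF`, `qeStar`, `Generic`), `…Part2` (`qeStar_eq`, `sum_curl_remF`,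
`pNormSq_add`, `pInner_neg_right`, `pNormSq_nonneg`, `curlF_sub`), `…Part3` (`pNormSq_remF`, `generic_scale`), `…Part5` (`energyC_eq_energy`), `…Part6`
(`resE`, `resR`, `fibreEnergy_eq`), `BIJ85Prop712Fibre.tensorInner_add_kernel`, r15's `tau1Sym`/`tau2Sym` via p10's `sigmaSym`.
WHAT IS KERNEL-CHECKED (zero `sorry`, standard axioms; theorems only — no `def`, no new named fact, D-0026): §1 p10's fibre algebra WITHOUT
the constraint: **`energy_eq_pNormSq_add`** (`‖∂A − Q^{e*}_kf‖² = ‖∂(A − B₀)‖² + ‖R‖²`), `pNormSq_remF_le_energy`, `energy_bZero`, `pNormSq_remF_re`;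
§2 **`fibreMinU_eq_two_mul_tau1Form`** (`fibreMinU (2M+1) N p′ φ = 2·Re⟨φ, τ₁(p′)φ⟩`, generic `p′`, two-forms `φ`, `0 < d`),
**`fibreMin_sub_fibreMinU_eq_two_mul_tau2Form`** (`m_{p′} − m°_{p′} = 2·Re⟨φ, τ₂(p′)φ⟩`), `tau1Form_nonneg`, **`tau2Form_nonneg`** (`τ₂(p′) ≥ 0` on
two-forms), `fibreMinU_congr_n`; §3 for the operators of record (`k ≤ m + K`, `2 ≤ d`, any `c ≠ 0`): at EVERY `p′` — `symb_sub`,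
`tau2Matrix_eq_sigmaMatrix_sub`, **`symb_tau2Matrix_form_eq_half_sub`** (`⟨ψ, τ₂(p′)ψ⟩ = ½(m_{p′} − m°_{p′})(ψ^asym)`), `symb_tau1Matrix_form_re_nonneg`,
**`symb_tau2Matrix_form_re_nonneg`**, `symb_sigmaMatrix_form_eq_add`; at generic `p′` (`L^k = 2M + 1`, all `p′_μ ≠ 0`) —
**`symb_tau1Matrix_form_eq_tau1Sym`**, **`symb_tau2Matrix_form_eq_tau2Sym`**.  HONEST SCOPE: on the axis fibres only the closed-form-free
identities (`½·m°`, `½(m − m°)`) and positivity are claimed (the printed symbols (7.1.14)–(7.1.16) are singular there, G-C1-03); even block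
sizes do not occur in `Setup`.
-/

namespace Literature.MathematicalPhysics.QuantumFieldTheory.BalabanImbrieJaffe1984to88.BIJ85Eq7114Tau1Identification

open scoped BigOperators RealInnerProductSpace Matrix ComplexConjugate
open Literature.MathematicalPhysics.QuantumFieldTheory.Balaban1983to89
open B5Prop11Plancherel (Tor fine sOf abs_sOf_le)
open B5Eq117TorusCarriers (Mk)
open BIJ85MomentumSymbols71 (tensorInner lShifts tau1Sym tau2Sym)
open BIJ85CurlComplement719 (IsTwoForm)
open BIJ85Thm711Fibrewise (Scale sigmaSym)
open BIJ85Prop712Fibre (tensorInner_add_kernel)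
open BIJ85Eq7113Derivation (Generic energy bZero remF pNormSq pInner curlF qeStar)
open BIJ85Eq7113DerivationPart2 (qeStar_eq sum_curl_remF pNormSq_add pInner_neg_right pNormSq_nonneg curlF_sub)
open BIJ85Eq7113DerivationPart3 (pNormSq_remF generic_scale)
open BIJ85Eq7113DerivationPart5 (energyC energyC_eq_energy)
open BIJ85Eq7113DerivationPart6 (resE resR fibreEnergy_eq)
open BIJ85Eq7112FibreEnergy (fibreEnergy)
open BIJ85Eq712Plancherel (symb symb_apply)
open BIJ85Sigma712Torus (Orient torN sigmaMatrix)
open BIJ85Sigma421Torus BIJ85Eq7112FibreMin BIJ85Eq7112SymbolFibreMin BIJ85Eq7113SymbolIdentification BIJ85Eq7117FibreMinFree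
  BIJ85Eq7117Tau1Symbol

noncomputable section

variable {d : ℕ}

/-! ## §1 p10's fibre algebra without the constraint: `min_A ‖∂A − Q^{e*}_kf‖² = ‖R‖² = ⟨f, τ₁f⟩` -/

section Free

variable {η : ℝ} {M : ℕ} {p : Fin d → ℝ}

/-- kernel: `pNormSq` of a negated field. [folklore] -/
private theorem pNormSq_neg (X : (Fin d → ℤ) → Fin d → Fin d → ℂ) : pNormSq M (fun m μ ν => -X m μ ν) = pNormSq M X := by
  unfold pNormSq
  simp only [norm_neg]

/-- **`‖∂A − Q^{e*}_kf‖² = ‖∂(A − B₀)‖² + ‖R‖²` at a generic fibre** for EVERY `A` (no constraint): the pointwise Hodge split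
`Q^{e*}_kf = ∂B₀ + R` (p10's `qeStar_eq`) with `R ⟂` all curls (`sum_curl_remF`). [cite: BalabanImbrieJaffe1985, (7.1.17) p.323] -/
theorem energy_eq_pNormSq_add (hG : Generic η M p) {f : Fin d → Fin d → ℂ} (hf : IsTwoForm f) (A : (Fin d → ℤ) → Fin d → ℂ) :
    energy η M p A f = pNormSq M (curlF η p (fun m μ => A m μ - bZero η p f m μ)) + pNormSq M (remF η p f) := by
  have hpt : (fun m μ ν => curlF η p A m μ ν - qeStar η p f m μ ν)
      = fun m μ ν => curlF η p (fun m μ => A m μ - bZero η p f m μ) m μ ν + -remF η p f m μ ν := by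
    funext m μ ν
    rw [qeStar_eq (η := η) (p := p) hf m μ ν, curlF_sub]
    ring
  have hcross : pInner M (curlF η p (fun m μ => A m μ - bZero η p f m μ)) (fun m μ ν => -remF η p f m μ ν) = 0 := by
    rw [pInner_neg_right, neg_eq_zero]
    unfold pInner
    rw [Finset.sum_eq_zero fun m hm => sum_curl_remF hG f _ hm, mul_zero]
  unfold energy
  rw [hpt, pNormSq_add, hcross, Complex.zero_re, mul_zero, add_zero, pNormSq_neg]

/-- **`‖R‖² ≤ ‖∂A − Q^{e*}_kf‖²` for every `A`.** [cite: BalabanImbrieJaffe1985, (7.1.17) p.323] -/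
theorem pNormSq_remF_le_energy (hG : Generic η M p) {f : Fin d → Fin d → ℂ} (hf : IsTwoForm f) (A : (Fin d → ℤ) → Fin d → ℂ) :
    pNormSq M (remF η p f) ≤ energy η M p A f := by
  rw [energy_eq_pNormSq_add hG hf A]
  exact le_add_of_nonneg_left (pNormSq_nonneg _)

/-- **The unconstrained minimum is attained at `A = B₀`**: `‖∂B₀ − Q^{e*}_kf‖² = ‖R‖²`. [cite: BalabanImbrieJaffe1985, (7.1.17) p.323] -/
theorem energy_bZero (hG : Generic η M p) {f : Fin d → Fin d → ℂ} (hf : IsTwoForm f) :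
    energy η M p (bZero η p f) f = pNormSq M (remF η p f) := by
  rw [energy_eq_pNormSq_add hG hf]
  have h0 : pNormSq M (curlF η p (fun m μ => bZero η p f m μ - bZero η p f m μ)) = 0 := by
    unfold pNormSq curlF
    simp
  rw [h0, zero_add]

/-- `‖R‖² = Re⟨f, τ₁(p′)f⟩` with r15's (7.1.14) symbol (p10's `pNormSq_remF`, real part). [cite: BalabanImbrieJaffe1985, (7.1.14) p.322] -/
theorem pNormSq_remF_re (f : Fin d → Fin d → ℂ) : pNormSq M (remF η p f) = (tensorInner f (tau1Sym η M p) f).re := by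
  rw [← pNormSq_remF f, Complex.ofReal_re]

end Free

/-! ## §2 The unconstrained fibre minimum in closed form at generic momenta -/

section Generic

variable (M : ℕ) {N : Fin d → ℕ} [∀ μ, NeZero (N μ)]

/-- **`fibreMinU (2M+1) N p′ φ = 2·Re⟨φ, τ₁(p′)φ⟩`** for every two-form `φ` at every dual momentum `p′` with all `p′_μ ≠ 0` — r15's
`tau1Sym` (7.1.14) verbatim at `η = 1/(2M+1)`, cut-off `M` (the `2` = ordered-pair convention). [cite: BalabanImbrieJaffe1985, (7.1.14) p.322] -/
theorem fibreMinU_eq_two_mul_tau1Form (hd : 0 < d) (q : Tor N) (hq : ∀ i, sOf N q i ≠ 0) {φ : Fin d × Fin d → ℂ}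
    (hφ : ∀ μ ν, φ (ν, μ) = -φ (μ, ν)) :
    fibreMinU (2 * M + 1) N q φ
      = 2 * (tensorInner (fun μ ν => φ (μ, ν)) (tau1Sym (((2 * M + 1 : ℕ) : ℝ)⁻¹) M (sOf N q)) (fun μ ν => φ (μ, ν))).re := by
  have hn : 0 < 2 * M + 1 := by omega
  have hp : ∀ i, sOf N q i ≠ 0 ∧ |sOf N q i| ≤ Real.pi := fun i => ⟨hq i, abs_sOf_le N q i⟩
  have hf : IsTwoForm (fun μ ν => φ (μ, ν)) := fun μ ν => hφ μ ν
  have hG : Generic (((2 * M + 1 : ℕ) : ℝ)⁻¹) M (sOf N q) := generic_scale hd ⟨2 * M + 1, M, le_rfl⟩ hp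
  rw [← pNormSq_remF_re]
  apply le_antisymm
  · -- `≤`: the fibre family read off `B₀`
    set α : (Fin d → Fin (2 * M + 1)) → Fin d → ℂ := fun k => bZero (((2 * M + 1 : ℕ) : ℝ)⁻¹) (sOf N q) (fun μ ν => φ (μ, ν)) (resR M k)
      with hα
    have hcomp : (fun m => α (resE M m)) = fun m => bZero (((2 * M + 1 : ℕ) : ℝ)⁻¹) (sOf N q) (fun μ ν => φ (μ, ν)) (resR M (resE M m)) := rfl
    calc fibreMinU (2 * M + 1) N q φ ≤ fibreEnergy (2 * M + 1) N q α φ := fibreMinU_le _ _ q α φ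
      _ = 2 * energyC (2 * M + 1) M (sOf N q) (fun m => α (resE M m)) (fun μ ν => φ (μ, ν)) := fibreEnergy_eq M q α hφ
      _ = _ := by rw [hcomp, energyC_comp_res, energyC_eq_energy hn hp _ hf, energy_bZero hG hf]
  · -- `≥`
    refine (le_fibreMinU_iff _ _).2 fun α => ?_
    rw [fibreEnergy_eq M q α hφ, energyC_eq_energy hn hp _ hf]
    have h := pNormSq_remF_le_energy hG hf (fun m => α (resE M m))
    linarith

/-- **`m_{p′}(φ) − m°_{p′}(φ) = 2·Re⟨φ, τ₂(p′)φ⟩`**: constrained minus unconstrained fibre minimum is r15's (7.1.15)–(7.1.16) form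
`tau2Sym` verbatim (generic `p′`, two-forms `φ`) — by `BIJ85Eq7113SymbolIdentification.fibreMin_eq_two_mul_sigmaForm` (σ = τ₁ + τ₂) and
`fibreMinU_eq_two_mul_tau1Form`. [cite: BalabanImbrieJaffe1985, (7.1.15) p.323] -/
theorem fibreMin_sub_fibreMinU_eq_two_mul_tau2Form (hd : 0 < d) (q : Tor N) (hq : ∀ i, sOf N q i ≠ 0) {φ : Fin d × Fin d → ℂ}
    (hφ : ∀ μ ν, φ (ν, μ) = -φ (μ, ν)) :
    fibreMin (2 * M + 1) N q φ - fibreMinU (2 * M + 1) N q φ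
      = 2 * (tensorInner (fun μ ν => φ (μ, ν)) (tau2Sym (((2 * M + 1 : ℕ) : ℝ)⁻¹) M (sOf N q)) (fun μ ν => φ (μ, ν))).re := by
  rw [fibreMin_eq_two_mul_sigmaForm M hd q hq hφ, fibreMinU_eq_two_mul_tau1Form M hd q hq hφ]
  unfold sigmaSym
  rw [tensorInner_add_kernel, Complex.add_re]
  ring

/-- **`τ₁(p′) ≥ 0` on two-forms** (generic `p′`): `0 ≤ Re⟨φ, τ₁(p′)φ⟩`. [cite: BalabanImbrieJaffe1985, (7.1.14) p.322] -/
theorem tau1Form_nonneg (hd : 0 < d) (q : Tor N) (hq : ∀ i, sOf N q i ≠ 0) {φ : Fin d × Fin d → ℂ}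
    (hφ : ∀ μ ν, φ (ν, μ) = -φ (μ, ν)) :
    0 ≤ (tensorInner (fun μ ν => φ (μ, ν)) (tau1Sym (((2 * M + 1 : ℕ) : ℝ)⁻¹) M (sOf N q)) (fun μ ν => φ (μ, ν))).re := by
  have h := fibreMinU_eq_two_mul_tau1Form M hd q hq hφ
  have h' := fibreMinU_nonneg (2 * M + 1) N q φ
  linarith

/-- **`τ₂(p′) ≥ 0` on two-forms** (generic `p′`): `0 ≤ Re⟨φ, τ₂(p′)φ⟩` — the (7.1.15) piece of `σ_k = τ₁ + τ₂` is itself a positive form,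
since the constrained fibre minimum dominates the unconstrained one. [cite: BalabanImbrieJaffe1985, (7.1.15) p.323] -/
theorem tau2Form_nonneg (hd : 0 < d) (q : Tor N) (hq : ∀ i, sOf N q i ≠ 0) {φ : Fin d × Fin d → ℂ}
    (hφ : ∀ μ ν, φ (ν, μ) = -φ (μ, ν)) :
    0 ≤ (tensorInner (fun μ ν => φ (μ, ν)) (tau2Sym (((2 * M + 1 : ℕ) : ℝ)⁻¹) M (sOf N q)) (fun μ ν => φ (μ, ν))).re := by
  have h := fibreMin_sub_fibreMinU_eq_two_mul_tau2Form M hd q hq hφ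
  have h' := fibreMinU_le_fibreMin (2 * M + 1) N q φ
  linarith

/-- Re-indexing the block size along an equation. [cite: BalabanImbrieJaffe1985, (7.1.17) p.323] -/
theorem fibreMinU_congr_n {n n' : ℕ} [NeZero n] [NeZero n'] (h : n = n') (N : Fin d → ℕ) [∀ μ, NeZero (N μ)] (q : Tor N)
    (φ : Fin d × Fin d → ℂ) : fibreMinU n N q φ = fibreMinU n' N q φ := by
  subst h
  rfl

end Generic

/-! ## §3 The operators of record: `τ₁(p′)` is (7.1.14), `τ₂(p′)` is (7.1.15) -/

section Record

variable {P : Params} {k : ℕ}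

/-- The symbol is additive: `symb (A − B) p = symb A p − symb B p`. [cite: BalabanImbrieJaffe1985, (7.1.2) p.321] -/
theorem symb_sub {N : Fin P.d → ℕ} [∀ μ, NeZero (N μ)] {m : Type*} (A B : Matrix (Tor N × m) (Tor N × m) ℂ) (p : Tor N) :
    symb N m (A - B) p = symb N m A p - symb N m B p := by
  ext i j
  simp only [symb_apply, Matrix.sub_apply, sub_mul, Finset.sum_sub_distrib]

/-- `τ₂ = σ_k − τ₁` at the matrix level. [cite: BalabanImbrieJaffe1985, (7.1.13) p.322] -/
theorem tau2Matrix_eq_sigmaMatrix_sub (hd : 2 ≤ P.d) (w c : ℝ) (k : ℕ) :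
    tau2Matrix (P := P) hd w c k = sigmaMatrix hd w c k - tau1Matrix hd w c k := by
  rw [sigmaMatrix_eq_tau1Matrix_add_tau2Matrix, add_sub_cancel_left]

/-- **`⟨ψ, τ₂(p′)ψ⟩ = ½·(m_{p′} − m°_{p′})(ψ^asym)` at EVERY dual momentum `p′`** (axes included): the symbol of p33's
`τ₂ = σ_k − τ₁` of record (weight `η^d`, any curl factor `c ≠ 0`; `k ≤ m + K`, `2 ≤ d`) is half the gap between the constrained (7.1.12)
and the unconstrained (7.1.17) fibre minima. [cite: BalabanImbrieJaffe1985, (7.1.13) p.322] -/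
theorem symb_tau2Matrix_form_eq_half_sub (hd : 2 ≤ P.d) (hk : k ≤ P.m + P.K) {c : ℝ} (hc : c ≠ 0) (p : Tor (torN P k))
    (ψ : Orient P → ℂ) :
    star ψ ⬝ᵥ (symb (torN P k) (Orient P) (tau2Matrix hd (P.eta k ^ P.d) c k) p *ᵥ ψ)
      = ((((1 / 2 : ℝ) * (fibreMin (P.L ^ k) (Mk P k) p (asymO ψ) - fibreMinU (P.L ^ k) (Mk P k) p (asymO ψ)) : ℝ)) : ℂ) := by
  rw [tau2Matrix_eq_sigmaMatrix_sub, symb_sub, Matrix.sub_mulVec, dotProduct_sub, symb_sigmaMatrix_form_eq_half_fibreMin hd hk hc p ψ,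
    symb_tau1Matrix_form_eq_half_fibreMinU hd hk hc p ψ]
  push_cast
  ring

/-- **`τ₁(p′) ≥ 0` for the τ₁ of record at EVERY `p′`**: `0 ≤ Re⟨ψ, τ₁(p′)ψ⟩`. [cite: BalabanImbrieJaffe1985, (7.1.17) p.323] -/
theorem symb_tau1Matrix_form_re_nonneg (hd : 2 ≤ P.d) (hk : k ≤ P.m + P.K) {c : ℝ} (hc : c ≠ 0) (p : Tor (torN P k))
    (ψ : Orient P → ℂ) : 0 ≤ (star ψ ⬝ᵥ (symb (torN P k) (Orient P) (tau1Matrix hd (P.eta k ^ P.d) c k) p *ᵥ ψ)).re := by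
  rw [symb_tau1Matrix_form_eq_half_fibreMinU hd hk hc p ψ, Complex.ofReal_re]
  exact mul_nonneg (by norm_num) (fibreMinU_nonneg _ _ p _)

/-- **`τ₂(p′) ≥ 0` for the τ₂ of record at EVERY `p′`** (axes included): `0 ≤ Re⟨ψ, τ₂(p′)ψ⟩`, since `m°_{p′} ≤ m_{p′}`
(`BIJ85Eq7117FibreMinFree.fibreMinU_le_fibreMin`). [cite: BalabanImbrieJaffe1985, (7.1.13) p.322] -/
theorem symb_tau2Matrix_form_re_nonneg (hd : 2 ≤ P.d) (hk : k ≤ P.m + P.K) {c : ℝ} (hc : c ≠ 0) (p : Tor (torN P k))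
    (ψ : Orient P → ℂ) : 0 ≤ (star ψ ⬝ᵥ (symb (torN P k) (Orient P) (tau2Matrix hd (P.eta k ^ P.d) c k) p *ᵥ ψ)).re := by
  rw [symb_tau2Matrix_form_eq_half_sub hd hk hc p ψ, Complex.ofReal_re]
  exact mul_nonneg (by norm_num) (sub_nonneg.2 (fibreMinU_le_fibreMin _ _ p _))

/-- **`τ₁(p′)` OF THE τ₁ OF RECORD IS (7.1.14)**: for p33's `τ₁ = Q^e_k(I − P_∂)Q^{e*}_k` on the torus (weight `η^d`, `η = L^{−k}`, any curl
factor `c ≠ 0`; `k ≤ m + K`, `2 ≤ d`, `L^k = 2M + 1`), at every dual momentum `p′` of `T₁^{(k)}` with all `p′_μ ≠ 0` and every fibre vector `ψ`: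
`⟨ψ, τ₁(p′)ψ⟩ = Re⟨ψ^asym, tau1Sym η M (p′) ψ^asym⟩` (r15's (7.1.14) verbatim). [cite: BalabanImbrieJaffe1985, (7.1.14) p.322] -/
theorem symb_tau1Matrix_form_eq_tau1Sym (hd : 2 ≤ P.d) (hk : k ≤ P.m + P.K) {c : ℝ} (hc : c ≠ 0) {M : ℕ} (hM : P.L ^ k = 2 * M + 1)
    (p : Tor (torN P k)) (hp : ∀ i, sOf (Mk P k) p i ≠ 0) (ψ : Orient P → ℂ) :
    star ψ ⬝ᵥ (symb (torN P k) (Orient P) (tau1Matrix hd (P.eta k ^ P.d) c k) p *ᵥ ψ)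
      = (((tensorInner (fun μ ν => asymO ψ (μ, ν)) (tau1Sym (P.eta k) M (sOf (Mk P k) p)) (fun μ ν => asymO ψ (μ, ν))).re : ℝ) : ℂ) := by
  haveI : NeZero (2 * M + 1) := ⟨by omega⟩
  rw [symb_tau1Matrix_form_eq_half_fibreMinU hd hk hc p ψ, fibreMinU_congr_n hM,
    fibreMinU_eq_two_mul_tau1Form M (by omega : 0 < P.d) p hp (asymO_swap ψ), eta_eq_inv_of_pow_eq hM]
  push_cast
  ring

/-- **`τ₂(p′)` OF THE τ₂ OF RECORD IS (7.1.15)**: for p33's `τ₂ = σ_k − τ₁ = Q^e_k(P_∂ − ∂G_{k,Ax}∂^*)Q^{e*}_k` on the torus (same standing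
hypotheses), at every dual momentum off the axes: `⟨ψ, τ₂(p′)ψ⟩ = Re⟨ψ^asym, tau2Sym η M (p′) ψ^asym⟩` (r15's (7.1.15)–(7.1.16) verbatim) —
the gap `½(m_{p′} − m°_{p′})` (`symb_tau2Matrix_form_eq_half_sub`) in closed form (`fibreMin_sub_fibreMinU_eq_two_mul_tau2Form`); equivalently,
by difference from `σ_k(p′) = τ₁ + τ₂` (`BIJ85Eq7113SymbolIdentification.symb_sigmaMatrix_form_eq_sigmaSym`) and (7.1.14) above.
[cite: BalabanImbrieJaffe1985, (7.1.15) p.323] -/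
theorem symb_tau2Matrix_form_eq_tau2Sym (hd : 2 ≤ P.d) (hk : k ≤ P.m + P.K) {c : ℝ} (hc : c ≠ 0) {M : ℕ} (hM : P.L ^ k = 2 * M + 1)
    (p : Tor (torN P k)) (hp : ∀ i, sOf (Mk P k) p i ≠ 0) (ψ : Orient P → ℂ) :
    star ψ ⬝ᵥ (symb (torN P k) (Orient P) (tau2Matrix hd (P.eta k ^ P.d) c k) p *ᵥ ψ)
      = (((tensorInner (fun μ ν => asymO ψ (μ, ν)) (tau2Sym (P.eta k) M (sOf (Mk P k) p)) (fun μ ν => asymO ψ (μ, ν))).re : ℝ) : ℂ) := by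
  haveI : NeZero (2 * M + 1) := ⟨by omega⟩
  rw [symb_tau2Matrix_form_eq_half_sub hd hk hc p ψ, fibreMinU_congr_n hM, fibreMin_congr_n hM,
    fibreMin_sub_fibreMinU_eq_two_mul_tau2Form M (by omega : 0 < P.d) p hp (asymO_swap ψ), eta_eq_inv_of_pow_eq hM]
  push_cast
  ring

/-- Consistency with the difference route: `⟨ψ, σ_k(p′)ψ⟩ = ⟨ψ, τ₁(p′)ψ⟩ + ⟨ψ, τ₂(p′)ψ⟩` at every `p′`. [cite: BalabanImbrieJaffe1985, (7.1.13) p.322] -/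
theorem symb_sigmaMatrix_form_eq_add (hd : 2 ≤ P.d) (w c : ℝ) (k : ℕ) (p : Tor (torN P k)) (ψ : Orient P → ℂ) :
    star ψ ⬝ᵥ (symb (torN P k) (Orient P) (sigmaMatrix hd w c k) p *ᵥ ψ)
      = star ψ ⬝ᵥ (symb (torN P k) (Orient P) (tau1Matrix hd w c k) p *ᵥ ψ)
        + star ψ ⬝ᵥ (symb (torN P k) (Orient P) (tau2Matrix hd w c k) p *ᵥ ψ) := by
  rw [tau2Matrix_eq_sigmaMatrix_sub, symb_sub, Matrix.sub_mulVec, dotProduct_sub, add_sub_cancel]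

end Record

end

end Literature.MathematicalPhysics.QuantumFieldTheory.BalabanImbrieJaffe1984to88.BIJ85Eq7114Tau1Identification
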